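import Mathlib.Analysis.SpecialFunctions.Pow.Real
import Mathlib.Analysis.SpecialFunctions.Sqrt
import Summits.CriticalPhenomena.PercolationContinuityZ3.Theorems.PercNearOneGluingNoHeavyLowerTailSuperTerminalQuarticR6
import HarnessLib

/-!
# `V4` is stable under parallel composition at `{s,a,b,c}` (modulo the universal `(Q6)` law)

Support file for crux `stmt-CriticalPhenomena-4575` (`NoHeavyLowerTail`), seat `prim-nh-lead-4575` lead gen 134 (`--supports stmt-CriticalPhenomena-4575`;
memo `run/shared/lean/prim/prim-nh-lead-4575/FROM-prim-nh-lead-4575-g134-V4-PARALLEL-CLOSURE.md`).  No definitions, no sorries, standard axioms.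
Third of three files (`…SuperTerminalQuarticOneSided` → `…SuperTerminalQuarticR6` → this); companion of `…SuperTerminalQuarticParallel` (gen 131) and
`…SuperTerminalQuarticOrdered` (gen 132), whose hypothesis `(H1)` on the absorbed piece is FALSE in general — here it is replaced by a THEOREM.

Setting (as there).  Two 4-terminal gadgets glued at `s, a, b, c`; cells of the 4-point partition law of a gadget: `n = P(s|a|b|c)`, `σ = P(sa|b|c)`,
`ζ = P(sa|cb)`, `β = P(cb|s|a)`, `ξs = P(sc|a|b)`, `ξa = P(ac|s|b)`, `τ = P(sac|b)`, `γ = P(c singleton)`; `V4` of a gadget: `σ⁴ ≤ (σ+ζ)²(σ+τ)²γ`;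
`(Q6)_c` of the gadget with the pair `s–a` given weight one: `(n+σ)⁶ ≤ γ²(n+σ+β+ζ)³(n+σ+ξs+ξa+τ)³` — a THEOREM for every finite weighted graph
(`…ThreePointIsoSexticUniversal.isoSexticPort_all`: its four events are `{π ≤ sa|b|c}`, `{π ≤ c|sab}`, `{π ≤ sa|bc}`, `{π ≤ sac|b}` of the gadget).
By the join rule (`Literature.Probability.Percolation.PartitionLatticeGluing.real_partLE`) the composite has
`Q = (n+σ)(n'+σ') − n n'`, `A = (n+σ+β+ζ)(n'+σ'+β'+ζ') − (n+β)(n'+β')`,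
`B = (n+σ+ξs+ξa+τ)(n'+σ'+ξs'+ξa'+τ') − (n+ξs)(n'+ξs') − (n+ξa)(n'+ξa') + n n'`, `C = γγ'`.

* `two_piece` — THEOREM A of the memo in the seven variables `n, σ, U ≥ n, W ≥ n, A ≥ σ, B ≥ σ, γ` per piece:
  `V4 ∧ (Q6)_c` for both ⟹ `(σσ'+σn'+nσ')⁴ ≤ (AA'+AU'+UA')²(BB'+BW'+WB')²γγ'`  (normalise with `piece`, apply `SuperTerminalQuarticR6.r6`, clear denominators);
* `quartic_stable` — MAIN THEOREM in the cells: **`[V4 ∧ (Q6)_c](piece 1) ∧ [V4 ∧ (Q6)_c](piece 2) ⟹ V4(composite)`** (`U = n+β`, `A = σ+ζ`,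
  `W = n+ξs+ξa`, `B = σ+τ`; the composite's `B` exceeds `BB'+BW'+WB'` by `ξsξa'+ξaξs' ≥ 0`).
Since `(Q6)_c` holds for every graph piece, `V4` is closed under gluing at the four terminals, and `V4` on all finite weighted graphs reduces to
`{s,a,b,c}`-prime graphs (memo §4; graph-level assembly = join rule + `isoSexticPort_all` + this theorem).
-/

namespace Summit.CriticalPhenomena.PercolationContinuityZ3.Theorems.SuperTerminalQuarticStable

open Real
open Summit.CriticalPhenomena.PercolationContinuityZ3.Theorems.SuperTerminalQuarticR6

/-- **Normalisation of one piece.**  From `n, σ, γ ≥ 0`, `U ≥ n`, `W ≥ n`, `A ≥ σ`, `B ≥ σ`, `n+σ > 0`, `V4`: `σ⁴ ≤ A²B²γ` and `(Q6)_c`: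
`(n+σ)⁶ ≤ γ²(A+U)³(B+W)³`, the normalised variables `t = n/(n+σ)`, `a = U/(A+U)`, `b = W/(B+W)`, `Φ = √γ(A+U)(B+W)/(n+σ)²` lie in the closed
box and satisfy the five hypotheses of `SuperTerminalQuarticR6.r6`. [this work] -/
theorem piece {n σ U A W B γ : ℝ} (hn : 0 ≤ n) (hσ : 0 ≤ σ) (hγ : 0 ≤ γ) (hU : n ≤ U) (hW : n ≤ W)
    (hA : σ ≤ A) (hB : σ ≤ B) (hm : 0 < n + σ)
    (hV : σ ^ 4 ≤ A ^ 2 * B ^ 2 * γ) (hS : (n + σ) ^ 6 ≤ γ ^ 2 * (A + U) ^ 3 * (B + W) ^ 3) :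
    (0 ≤ n / (n + σ) ∧ n / (n + σ) ≤ 1 ∧ 0 ≤ U / (A + U) ∧ U / (A + U) ≤ 1 ∧ 0 ≤ W / (B + W) ∧ W / (B + W) ≤ 1 ∧
      0 ≤ Real.sqrt γ * (A + U) * (B + W) / (n + σ) ^ 2) ∧
    (1 - n / (n + σ)) ^ 2 ≤ Real.sqrt γ * (A + U) * (B + W) / (n + σ) ^ 2 * ((1 - U / (A + U)) * (1 - W / (B + W))) ∧
    (n / (n + σ)) ^ 2 ≤ (Real.sqrt γ * (A + U) * (B + W) / (n + σ) ^ 2) ^ 4 * (U / (A + U) * (W / (B + W))) ∧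
    (1 - n / (n + σ)) ^ 2 ≤ (Real.sqrt γ * (A + U) * (B + W) / (n + σ) ^ 2) ^ 4 * ((1 - U / (A + U)) * (1 - W / (B + W))) ∧
    n / (n + σ) * (1 - n / (n + σ)) ≤ (Real.sqrt γ * (A + U) * (B + W) / (n + σ) ^ 2) ^ 4 * ((1 - U / (A + U)) * (W / (B + W))) ∧
    n / (n + σ) * (1 - n / (n + σ)) ≤ (Real.sqrt γ * (A + U) * (B + W) / (n + σ) ^ 2) ^ 4 * (U / (A + U) * (1 - W / (B + W))) := by
  -- opaque names for `m = n+σ`, `P = A+U`, `R = B+W`, `s = √γ`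
  obtain ⟨m, hm_def⟩ : ∃ m, m = n + σ := ⟨_, rfl⟩
  obtain ⟨P, hP_def⟩ : ∃ P, P = A + U := ⟨_, rfl⟩
  obtain ⟨R, hR_def⟩ : ∃ R, R = B + W := ⟨_, rfl⟩
  obtain ⟨s, hs_def⟩ : ∃ s, s = Real.sqrt γ := ⟨_, rfl⟩
  rw [← hm_def, ← hP_def, ← hR_def] at hS
  rw [← hm_def, ← hP_def, ← hR_def, ← hs_def]
  rw [← hm_def] at hm
  have hA0 : 0 ≤ A := hσ.trans hA
  have hB0 : 0 ≤ B := hσ.trans hB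
  have hU0 : 0 ≤ U := hn.trans hU
  have hW0 : 0 ≤ W := hn.trans hW
  have hP : 0 < P := by rw [hP_def]; linarith
  have hR : 0 < R := by rw [hR_def]; linarith
  have hmne : m ≠ 0 := hm.ne'
  have hγpos : 0 < γ := by
    rcases eq_or_lt_of_le hγ with h | h
    · exfalso
      rw [← h] at hS
      have : 0 < m ^ 6 := by positivity
      nlinarith
    · exact h
  have hs : 0 < s := by rw [hs_def]; exact Real.sqrt_pos.2 hγpos
  have hs2 : s ^ 2 = γ := by rw [hs_def]; exact Real.sq_sqrt hγ
  have hs4 : s ^ 4 = γ ^ 2 := by rw [← hs2]; ring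
  -- the complements
  have et : 1 - n / m = σ / m := by
    rw [eq_div_iff hmne, sub_mul, div_mul_cancel₀ _ hmne, hm_def]; ring
  have ea : 1 - U / P = A / P := by
    rw [eq_div_iff hP.ne', sub_mul, div_mul_cancel₀ _ hP.ne', hP_def]; ring
  have eb : 1 - W / R = B / R := by
    rw [eq_div_iff hR.ne', sub_mul, div_mul_cancel₀ _ hR.ne', hR_def]; ring
  -- elementary products
  have pUW : n ^ 2 ≤ U * W := by nlinarith [mul_le_mul hU hW hn hU0]
  have pAB : σ ^ 2 ≤ A * B := by nlinarith [mul_le_mul hA hB hσ hA0]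
  have pAW : n * σ ≤ A * W := by nlinarith [mul_le_mul hA hW hn hA0]
  have pUB : n * σ ≤ U * B := by nlinarith [mul_le_mul hU hB hσ hU0]
  -- `σ² ≤ A B √γ` from `V4`
  have hV2 : σ ^ 2 ≤ A * B * s := by
    have h : (σ ^ 2) ^ 2 ≤ (A * B * s) ^ 2 := by
      calc (σ ^ 2) ^ 2 = σ ^ 4 := by ring
        _ ≤ A ^ 2 * B ^ 2 * γ := hV
        _ = (A * B * s) ^ 2 := by rw [← hs2]; ring
    exact (pow_le_pow_iff_left₀ (sq_nonneg σ) (by positivity) two_ne_zero).1 h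
  -- the common shape of the four `Φ⁴`-bounds
  have quart : ∀ {x y : ℝ}, 0 ≤ x → x ≤ y →
      x / m ^ 2 ≤ (s * P * R / m ^ 2) ^ 4 * (y / (P * R)) := by
    intro x y hx hxy
    rw [div_pow, div_mul_div_comm, div_le_div_iff₀ (by positivity) (by positivity)]
    have h1 : x * m ^ 6 ≤ y * (γ ^ 2 * P ^ 3 * R ^ 3) := mul_le_mul hxy hS (by positivity) (hx.trans hxy)
    calc x * ((m ^ 2) ^ 4 * (P * R)) = (x * m ^ 6) * (m ^ 2 * (P * R)) := by ring
      _ ≤ (y * (γ ^ 2 * P ^ 3 * R ^ 3)) * (m ^ 2 * (P * R)) := mul_le_mul_of_nonneg_right h1 (by positivity)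
      _ = (s * P * R) ^ 4 * y * m ^ 2 := by rw [← hs4]; ring
  have hnσ : n / m * (σ / m) = (n * σ) / m ^ 2 := by rw [div_mul_div_comm, ← sq]
  refine ⟨⟨by positivity, ?_, by positivity, ?_, by positivity, ?_, by positivity⟩, ?_, ?_, ?_, ?_, ?_⟩
  · exact (div_le_one hm).2 (by rw [hm_def]; linarith)
  · exact (div_le_one hP).2 (by rw [hP_def]; linarith)
  · exact (div_le_one hR).2 (by rw [hR_def]; linarith)
  · -- `V4`
    rw [et, ea, eb, div_pow, div_mul_div_comm A P B R, div_mul_div_comm, div_le_div_iff₀ (by positivity) (by positivity)]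
    calc σ ^ 2 * (m ^ 2 * (P * R)) = σ ^ 2 * (m ^ 2 * (P * R)) := rfl
      _ ≤ (A * B * s) * (m ^ 2 * (P * R)) := mul_le_mul_of_nonneg_right hV2 (by positivity)
      _ = s * P * R * (A * B) * m ^ 2 := by ring
  · rw [div_pow, div_mul_div_comm U P W R]
    exact quart (sq_nonneg n) pUW
  · rw [et, ea, eb, div_pow, div_mul_div_comm A P B R]
    exact quart (sq_nonneg σ) pAB
  · rw [et, ea, hnσ, div_mul_div_comm A P W R]
    exact quart (mul_nonneg hn hσ) pAW
  · rw [et, eb, hnσ, div_mul_div_comm U P B R]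
    exact quart (mul_nonneg hn hσ) pUB

/-- **THEOREM A (two-piece lemma; '`V4` is ∥-stable modulo `(Q6)_c`').**  For `i = 1,2` let `n_i, σ_i, γ_i ≥ 0`, `U_i ≥ n_i`, `W_i ≥ n_i`,
`A_i ≥ σ_i`, `B_i ≥ σ_i` with `V4`: `σ_i⁴ ≤ A_i²B_i²γ_i` and `(Q6)_c`: `(n_i+σ_i)⁶ ≤ γ_i²(A_i+U_i)³(B_i+W_i)³`.  Then
`(σσ' + σn' + nσ')⁴ ≤ (AA' + AU' + UA')²·(BB' + BW' + WB')²·γγ'`. [this work] -/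
theorem two_piece {n σ U A W B γ n' σ' U' A' W' B' γ' : ℝ}
    (hn : 0 ≤ n) (hσ : 0 ≤ σ) (hγ : 0 ≤ γ) (hU : n ≤ U) (hW : n ≤ W) (hA : σ ≤ A) (hB : σ ≤ B)
    (hV : σ ^ 4 ≤ A ^ 2 * B ^ 2 * γ) (hS : (n + σ) ^ 6 ≤ γ ^ 2 * (A + U) ^ 3 * (B + W) ^ 3)
    (hn' : 0 ≤ n') (hσ' : 0 ≤ σ') (hγ' : 0 ≤ γ') (hU' : n' ≤ U') (hW' : n' ≤ W') (hA' : σ' ≤ A') (hB' : σ' ≤ B')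
    (hV' : σ' ^ 4 ≤ A' ^ 2 * B' ^ 2 * γ') (hS' : (n' + σ') ^ 6 ≤ γ' ^ 2 * (A' + U') ^ 3 * (B' + W') ^ 3) :
    (σ * σ' + σ * n' + n * σ') ^ 4 ≤
      (A * A' + A * U' + U * A') ^ 2 * (B * B' + B * W' + W * B') ^ 2 * (γ * γ') := by
  have hRHS : 0 ≤ (A * A' + A * U' + U * A') ^ 2 * (B * B' + B * W' + W * B') ^ 2 * (γ * γ') := by positivity
  -- trivial pieces
  rcases eq_or_lt_of_le (add_nonneg hn hσ) with hm0 | hm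
  · have h1 : n = 0 := by linarith
    have h2 : σ = 0 := by linarith
    subst h1; subst h2; simpa using hRHS
  rcases eq_or_lt_of_le (add_nonneg hn' hσ') with hm0' | hm'
  · have h1 : n' = 0 := by linarith
    have h2 : σ' = 0 := by linarith
    subst h1; subst h2; simpa using hRHS
  -- normalise both pieces and apply `(R6)`
  obtain ⟨⟨r1, r2, r3, r4, r5, r6', r7⟩, k1, k2, k3, k4, k5⟩ := piece hn hσ hγ hU hW hA hB hm hV hS
  obtain ⟨⟨r1', r2', r3', r4', r5', r6'', r7'⟩, k1', k2', k3', k4', k5'⟩ := piece hn' hσ' hγ' hU' hW' hA' hB' hm' hV' hS'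
  have KEY := SuperTerminalQuarticR6.r6 r1 r2 r3 r4 r5 r6' r7 k1 k2 k3 k4 k5 r1' r2' r3' r4' r5' r6'' r7' k1' k2' k3' k4' k5'
  -- opaque names
  obtain ⟨m, hm_def⟩ : ∃ m, m = n + σ := ⟨_, rfl⟩
  obtain ⟨P, hP_def⟩ : ∃ P, P = A + U := ⟨_, rfl⟩
  obtain ⟨R, hR_def⟩ : ∃ R, R = B + W := ⟨_, rfl⟩
  obtain ⟨s, hs_def⟩ : ∃ s, s = Real.sqrt γ := ⟨_, rfl⟩
  obtain ⟨m', hm'_def⟩ : ∃ m', m' = n' + σ' := ⟨_, rfl⟩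
  obtain ⟨P', hP'_def⟩ : ∃ P', P' = A' + U' := ⟨_, rfl⟩
  obtain ⟨R', hR'_def⟩ : ∃ R', R' = B' + W' := ⟨_, rfl⟩
  obtain ⟨s', hs'_def⟩ : ∃ s', s' = Real.sqrt γ' := ⟨_, rfl⟩
  rw [← hm_def, ← hP_def, ← hR_def, ← hs_def, ← hm'_def, ← hP'_def, ← hR'_def, ← hs'_def] at KEY
  rw [← hm_def] at hm
  rw [← hm'_def] at hm'
  have hP : 0 < P := by rw [hP_def]; linarith
  have hR : 0 < R := by rw [hR_def]; linarith
  have hP' : 0 < P' := by rw [hP'_def]; linarith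
  have hR' : 0 < R' := by rw [hR'_def]; linarith
  have hmne : m ≠ 0 := hm.ne'
  have hmne' : m' ≠ 0 := hm'.ne'
  have hPne : P ≠ 0 := hP.ne'
  have hRne : R ≠ 0 := hR.ne'
  have hPne' : P' ≠ 0 := hP'.ne'
  have hRne' : R' ≠ 0 := hR'.ne'
  have hs0 : 0 ≤ s := by rw [hs_def]; exact Real.sqrt_nonneg _
  have hs0' : 0 ≤ s' := by rw [hs'_def]; exact Real.sqrt_nonneg _
  have hs2 : s ^ 2 = γ := by rw [hs_def]; exact Real.sq_sqrt hγ
  have hs2' : s' ^ 2 = γ' := by rw [hs'_def]; exact Real.sq_sqrt hγ'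
  -- the four identities
  have i1 : 1 - n / m * (n' / m') = (σ * σ' + σ * n' + n * σ') / (m * m') := by
    rw [eq_div_iff (mul_ne_zero hmne hmne')]
    field_simp
    rw [hm_def, hm'_def]; ring
  have i2 : 1 - U / P * (U' / P') = (A * A' + A * U' + U * A') / (P * P') := by
    rw [eq_div_iff (mul_ne_zero hPne hPne')]
    field_simp
    rw [hP_def, hP'_def]; ring
  have i3 : 1 - W / R * (W' / R') = (B * B' + B * W' + W * B') / (R * R') := by
    rw [eq_div_iff (mul_ne_zero hRne hRne')]
    field_simp
    rw [hR_def, hR'_def]; ring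
  have i4 : (A * A' + A * U' + U * A') / (P * P') * ((B * B' + B * W' + W * B') / (R * R')) *
      (s * P * R / m ^ 2 * (s' * P' * R' / m' ^ 2)) =
      ((A * A' + A * U' + U * A') * (B * B' + B * W' + W * B') * (s * s')) / (m * m') ^ 2 := by
    field_simp
  rw [i1, i2, i3, i4, div_pow, div_le_div_iff_of_pos_right (by positivity)] at KEY
  -- KEY : Q² ≤ Ac · Bc · (s s')
  have hX : 0 ≤ (A * A' + A * U' + U * A') * (B * B' + B * W' + W * B') * (s * s') := le_trans (sq_nonneg _) KEY
  calc (σ * σ' + σ * n' + n * σ') ^ 4 = ((σ * σ' + σ * n' + n * σ') ^ 2) ^ 2 := by ring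
    _ ≤ ((A * A' + A * U' + U * A') * (B * B' + B * W' + W * B') * (s * s')) ^ 2 :=
        pow_le_pow_left₀ (sq_nonneg _) KEY 2
    _ = (A * A' + A * U' + U * A') ^ 2 * (B * B' + B * W' + W * B') ^ 2 * (s ^ 2 * s' ^ 2) := by ring
    _ = (A * A' + A * U' + U * A') ^ 2 * (B * B' + B * W' + W * B') ^ 2 * (γ * γ') := by rw [hs2, hs2']

/-- **MAIN THEOREM: `V4` is stable under parallel composition at `{s,a,b,c}` modulo `(Q6)_c`.**  Piece 1 (cells unprimed) and piece 2
(cells primed) both satisfy `V4`: `σ⁴ ≤ (σ+ζ)²(σ+τ)²γ` and the sextic isolation law of the `s–a`-glued piece `(Q6)_c`: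
`(n+σ)⁶ ≤ γ²(n+σ+β+ζ)³(n+σ+ξs+ξa+τ)³` (a theorem for every finite weighted graph).  Then the composite cells
`Q = (n+σ)(n'+σ') − nn'`, `A = (n+σ+β+ζ)(n'+σ'+β'+ζ') − (n+β)(n'+β')`,
`B = (n+σ+ξs+ξa+τ)(n'+σ'+ξs'+ξa'+τ') − (n+ξs)(n'+ξs') − (n+ξa)(n'+ξa') + nn'`, `C = γγ'` satisfy `Q⁴ ≤ A²B²C`.  Hence `V4` on all finite
weighted graphs is equivalent to `V4` on `{s,a,b,c}`-prime graphs. [this work] -/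
theorem quartic_stable {n σ ζ β ξs ξa τ γ n' σ' ζ' β' ξs' ξa' τ' γ' : ℝ}
    (hn : 0 ≤ n) (hσ : 0 ≤ σ) (hζ : 0 ≤ ζ) (hβ : 0 ≤ β) (hξs : 0 ≤ ξs) (hξa : 0 ≤ ξa) (hτ : 0 ≤ τ) (hγ : 0 ≤ γ)
    (hn' : 0 ≤ n') (hσ' : 0 ≤ σ') (hζ' : 0 ≤ ζ') (hβ' : 0 ≤ β') (hξs' : 0 ≤ ξs') (hξa' : 0 ≤ ξa') (hτ' : 0 ≤ τ') (hγ' : 0 ≤ γ')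
    (hV : σ ^ 4 ≤ (σ + ζ) ^ 2 * (σ + τ) ^ 2 * γ)
    (hS : (n + σ) ^ 6 ≤ γ ^ 2 * (n + σ + β + ζ) ^ 3 * (n + σ + ξs + ξa + τ) ^ 3)
    (hV' : σ' ^ 4 ≤ (σ' + ζ') ^ 2 * (σ' + τ') ^ 2 * γ')
    (hS' : (n' + σ') ^ 6 ≤ γ' ^ 2 * (n' + σ' + β' + ζ') ^ 3 * (n' + σ' + ξs' + ξa' + τ') ^ 3) :
    ((n + σ) * (n' + σ') - n * n') ^ 4 ≤
      ((n + σ + β + ζ) * (n' + σ' + β' + ζ') - (n + β) * (n' + β')) ^ 2 *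
        ((n + σ + ξs + ξa + τ) * (n' + σ' + ξs' + ξa' + τ') - (n + ξs) * (n' + ξs') - (n + ξa) * (n' + ξa') + n * n') ^ 2 *
          (γ * γ') := by
  have eS : (n + σ + β + ζ) = (σ + ζ) + (n + β) := by ring
  have eT : (n + σ + ξs + ξa + τ) = (σ + τ) + (n + ξs + ξa) := by ring
  have eS' : (n' + σ' + β' + ζ') = (σ' + ζ') + (n' + β') := by ring
  have eT' : (n' + σ' + ξs' + ξa' + τ') = (σ' + τ') + (n' + ξs' + ξa') := by ring
  rw [eS, eT] at hS
  rw [eS', eT'] at hS'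
  have T := two_piece (U := n + β) (A := σ + ζ) (W := n + ξs + ξa) (B := σ + τ)
    (U' := n' + β') (A' := σ' + ζ') (W' := n' + ξs' + ξa') (B' := σ' + τ')
    hn hσ hγ (by linarith) (by linarith) (by linarith) (by linarith) hV hS
    hn' hσ' hγ' (by linarith) (by linarith) (by linarith) (by linarith) hV' hS'
  -- identify the composite cells
  have eQ : (n + σ) * (n' + σ') - n * n' = σ * σ' + σ * n' + n * σ' := by ring
  have eA : (n + σ + β + ζ) * (n' + σ' + β' + ζ') - (n + β) * (n' + β') =
      (σ + ζ) * (σ' + ζ') + (σ + ζ) * (n' + β') + (n + β) * (σ' + ζ') := by ring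
  have eB : (n + σ + ξs + ξa + τ) * (n' + σ' + ξs' + ξa' + τ') - (n + ξs) * (n' + ξs') - (n + ξa) * (n' + ξa') + n * n' =
      ((σ + τ) * (σ' + τ') + (σ + τ) * (n' + ξs' + ξa') + (n + ξs + ξa) * (σ' + τ')) + (ξs * ξa' + ξa * ξs') := by ring
  rw [eQ, eA, eB]
  have hB0 : 0 ≤ (σ + τ) * (σ' + τ') + (σ + τ) * (n' + ξs' + ξa') + (n + ξs + ξa) * (σ' + τ') := by positivity
  have hcross : 0 ≤ ξs * ξa' + ξa * ξs' := by positivity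
  have hsq : ((σ + τ) * (σ' + τ') + (σ + τ) * (n' + ξs' + ξa') + (n + ξs + ξa) * (σ' + τ')) ^ 2 ≤
      (((σ + τ) * (σ' + τ') + (σ + τ) * (n' + ξs' + ξa') + (n + ξs + ξa) * (σ' + τ')) + (ξs * ξa' + ξa * ξs')) ^ 2 :=
    pow_le_pow_left₀ hB0 (le_add_of_nonneg_right hcross) 2
  have hA2 : 0 ≤ ((σ + ζ) * (σ' + ζ') + (σ + ζ) * (n' + β') + (n + β) * (σ' + ζ')) ^ 2 := sq_nonneg _
  have hC : 0 ≤ γ * γ' := by positivity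
  exact le_trans T (mul_le_mul_of_nonneg_right (mul_le_mul_of_nonneg_left hsq hA2) hC)

end Summit.CriticalPhenomena.PercolationContinuityZ3.Theorems.SuperTerminalQuarticStable
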